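import Summits.BirchSwinnertonDyer.BirchSwinnertonDyer.Theorems.SignedLowerHalvesSmallImageLowerHalfBothSignsRttJunctionShaLocCountCore
import Summits.BirchSwinnertonDyer.BirchSwinnertonDyer.Theorems.SignedLowerHalvesSmallImageLowerHalfBothSignsRttD2SeqSemilocLayer
import Summits.BirchSwinnertonDyer.BirchSwinnertonDyer.Theorems.SignedLowerHalvesSmallImageLowerHalfBothSignsRttD2J2DeltaTower
import Summits.BirchSwinnertonDyer.BirchSwinnertonDyer.Theorems.SignedLowerHalvesSmallImageLowerHalfBothSignsRttJunctionShaLocBounded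
import Literature.NumberTheory.GaloisRepresentations.LocalDualityTwoZero
import Literature.NumberTheory.Automorphic.AdicCompletionLocalField
import HarnessLib

/-!
# Route `SignedLowerHalves`, crux L `SmallImageLowerHalfBothSigns` (stmt-BirchSwinnertonDyer-23599), line `rtt_w3` v30 — stub S3α′ (`stub_junctionShaPT_ns`),
# brick α2-lev (part 2): ★★★ THE LEVELWISE UNIFORM BOUND `#H²(Γ_{K_w}, Maps(Γ_K ⧸ U_n, X_k)) ≤ #(𝒪/p^m)^{p^e}` FOR THE DEGREE-2 SEMILOCAL IWASAWA MODULE AT A PLACE `w`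
# where `θ′` is non-trivial on `Gal(K̄_w / K_w K_∞(μ_{p^∞}))` and `w` is finitely decomposed in `K_∞`

INPUTS hand `bsd-inputs-honda-p1` g28 under LEAD `cruxlead-stmt-BirchSwinnertonDyer-23599` g14 (cell `bsd-ssimc`; TAKE-GRANT 2026-08-31T06:30Z «α2-lev»); helper
`--supports stmt-BirchSwinnertonDyer-23599`. THEOREMS ONLY (no definition, no named fact, no instance, no `sorry`). Sequel of part 1 (`…RttJunctionShaLocCountCore`: generic counts).
WHY. S3α′ asks for `ρ : I₂.H →ₗ Loc` with `Loc` FINITE; `ρ = ρ₂` (p814071) lands in `Π_{w∈P} (L₂ w).H`, finite iff every semilocal datum `L₂ w` has UNIFORMLY BOUNDED levels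
(LEAD g14 `finite_pi_semiloc_of_levels`, p813183). This file proves the levelwise bound from LOCAL hypotheses at `w` (all dischargeable from the frame at `w ∤ p`, part 3):
(τ) an element `τ ∈ Γ_{K_w}` lying in every layer group `U_n` (i.e. over `K_∞`), fixing `μ_{p^∞}` of `K̄_w` and acting on `𝒪 ⊗ μ_{p^k}(K̄) ⊗ θ′` as the scalar `u ∈ 𝒪` for every `k`, with
`u − 1 ∣ p^m` (at `w ∤ p`: a local inertia element with `θ′(τ) ≠ 1`, by (R) of `CharRoadFrameSupp`); (σ) an element `σ ∈ Γ_{K_w}` with `κ(res σ) = p^e · unit` (the decomposition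
group of `w` in `K_∞/K` has index `≤ p^e`: `w` finitely decomposed; at `w ∤ p` a Frobenius). PROOF: local Tate duality `(2,0)` (tree `natCard_two_eq_natCard_invariants_homRep`):
`#H² = #Hom_{Γ_w}(Maps(Γ_K ⧸ U_n, X_k), μ_{p^k})`; every coset of `Γ_K ⧸ U_n` is `res(σ)^t · [d.out]` for `d ∈ Γ_K ⧸ U_e` (`exists_pow_smul_mk_out_eq`), so part 1's orbit count gives
`≤ #{g : X_k →+ μ | g(τx) = τ g(x)}^{p^e}`; such `g` kill `(u−1)X_k ⊇ p^m X_k`-cokernel… precisely `#{…} ≤ #ker(u−1) ≤ #X_k[p^m] ≤ #(𝒪 ⊗ μ_{p^k})[p^m] ≤ #(𝒪/p^m)` (part 1).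
HONEST FRAMING: a local counting theorem with displayed hypotheses; the hypotheses at `vp` (height-two / Imai-type finiteness of `θ′` over `K_v(μ_{p^∞})`) are NOT discharged here;
nothing about S3α′, E2, crux L or BSD is proved; all remain OPEN and are proved for NO curve.

* §1 `exists_pow_smul_mk_out_eq` (orbit representatives in a `ℤ_p`-extension), `smul_eq_self_of_mem_layerSubgroup`.
* §2 ★★★ `finite_and_natCard_semilocCoh_two_le`, its `∃ B` packaging `exists_bound_semilocCoh_two`, and the limit form `finite_semilocIwasawaCohomologyDataO_two` (`(L₂ w).H` finite).
References: [NeukirchSchmidtWingberg2008] (7.2.6), (8.6.2)–(8.6.3), I §5–§6; [SerreGaloisCohomology1997] II §5.2 Thm. 2; [MilneADT2006] I Cor. 2.3; [PerrinRiou1994Invent] §1.3;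
[Rubin2000] App. B.3; [Washington1997] §13.1–§13.2.
-/

set_option autoImplicit false
set_option linter.dupNamespace false -- D-0017: single-problem summit, the namespace repeats the problem name by design
noncomputable section

open scoped Classical TensorProduct
open NumberField IsDedekindDomain Field CategoryTheory Function

namespace Summit.BirchSwinnertonDyer.BirchSwinnertonDyer.Theorems.SmallImageRttJunctionSha

open Literature.NumberTheory.EllipticCurves Literature.NumberTheory.GaloisRepresentations Literature.NumberTheory.GaloisRepresentations.DiscreteGaloisModule
  Literature.NumberTheory.ComplexMultiplication.EllipticUnits.JohnsonLeungKings2011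
  Summit.BirchSwinnertonDyer.BirchSwinnertonDyer.Theorems.SmallImageRttD2J1
  Summit.BirchSwinnertonDyer.BirchSwinnertonDyer.Theorems.SmallImageRttD2Seq

/-! ## §1 Orbit representatives in a `ℤ_p`-extension -/

section Orbits

variable {K : Type} [Field K] [NumberField K] {p : ℕ} [Fact p.Prime] (κ : ZpExtension K p)

omit [NumberField K] in
/-- ★ **Orbit representatives**: if `κ(g₀) = p^e · u₀` with `u₀ ∈ ℤ_pˣ`, every coset `y ∈ Γ_K ⧸ U_n` is `g₀^t · [d.out]` for some `t ∈ ℕ` and some `d ∈ Γ_K ⧸ U_e` (lift `y` to `x`, take `d = [x]`, so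
`κ(x) − κ(d.out) ∈ p^e ℤ_p = κ(g₀) ℤ_p`, and solve `t u₀ ≡ (κ x − κ d.out)/p^e (mod pⁿ)`). Hence the closed subgroup generated by `g₀` has at most `p^e` orbits on every `Γ_K ⧸ U_n`.
[cite: Washington1997, §13.1–§13.2] [folklore] -/
theorem exists_pow_smul_mk_out_eq {g₀ : absoluteGaloisGroup K} {e : ℕ} {u₀ : ℤ_[p]ˣ} (hg₀ : (κ g₀).toAdd = (p : ℤ_[p]) ^ e * u₀) (n : ℕ)
    (y : absoluteGaloisGroup K ⧸ κ.layerSubgroup n) :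
    ∃ (t : ℕ) (d : absoluteGaloisGroup K ⧸ κ.layerSubgroup e), y = g₀ ^ t • (QuotientGroup.mk d.out : absoluteGaloisGroup K ⧸ κ.layerSubgroup n) := by
  induction y using QuotientGroup.induction_on with
  | H x =>
    set d : absoluteGaloisGroup K ⧸ κ.layerSubgroup e := QuotientGroup.mk x with hd
    -- `d.out⁻¹ x ∈ U_e`
    have hx₀ : d.out⁻¹ * x ∈ κ.layerSubgroup e := by
      rw [← QuotientGroup.eq, QuotientGroup.out_eq', hd]
    rw [ZpExtension.mem_layerSubgroup, map_mul, map_inv, toAdd_mul, toAdd_inv] at hx₀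
    obtain ⟨b, hb⟩ := hx₀
    refine ⟨(PadicInt.toZModPow n (b * ((u₀⁻¹ : ℤ_[p]ˣ) : ℤ_[p]))).val, d, ?_⟩
    rw [MulAction.Quotient.smul_mk, smul_eq_mul, QuotientGroup.eq, ZpExtension.mem_layerSubgroup, map_mul κ, map_mul κ, map_inv κ, map_pow κ, toAdd_mul, toAdd_mul,
      toAdd_inv, toAdd_pow, hg₀, nsmul_eq_mul]
    -- `t ≡ b u₀⁻¹ (mod pⁿ)`
    have hmem : (((PadicInt.toZModPow n (b * ((u₀⁻¹ : ℤ_[p]ˣ) : ℤ_[p]))).val : ℕ) : ℤ_[p]) - b * ((u₀⁻¹ : ℤ_[p]ˣ) : ℤ_[p]) ∈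
        RingHom.ker (PadicInt.toZModPow n : ℤ_[p] →+* ZMod (p ^ n)) := by
      rw [RingHom.mem_ker, map_sub, map_natCast, ZMod.natCast_zmod_val, sub_self]
    rw [PadicInt.ker_toZModPow, Ideal.mem_span_singleton] at hmem
    -- `-κ x + (t p^e u₀ + κ d.out) = p^e u₀ (t - b u₀⁻¹)`
    have key : -(κ x).toAdd + ((((PadicInt.toZModPow n (b * ((u₀⁻¹ : ℤ_[p]ˣ) : ℤ_[p]))).val : ℕ) : ℤ_[p]) * ((p : ℤ_[p]) ^ e * u₀) + (κ d.out).toAdd) =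
        (p : ℤ_[p]) ^ e * (u₀ : ℤ_[p]) * ((((PadicInt.toZModPow n (b * ((u₀⁻¹ : ℤ_[p]ˣ) : ℤ_[p]))).val : ℕ) : ℤ_[p]) - b * ((u₀⁻¹ : ℤ_[p]ˣ) : ℤ_[p])) := by
      have hb' : (κ x).toAdd = (κ d.out).toAdd + (p : ℤ_[p]) ^ e * b := by
        rw [← hb]; abel
      rw [hb', mul_sub, show (p : ℤ_[p]) ^ e * (u₀ : ℤ_[p]) * (b * ((u₀⁻¹ : ℤ_[p]ˣ) : ℤ_[p])) = (p : ℤ_[p]) ^ e * b by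
        rw [mul_comm b, ← mul_assoc, mul_assoc ((p : ℤ_[p]) ^ e), Units.mul_inv, mul_one]]
      ring
    rw [key]
    exact (Dvd.dvd.mul_left hmem _).trans (by rw [mul_assoc])

omit [NumberField K] in
/-- An element of `U_n` acts trivially on `Γ_K ⧸ U_n` (`U_n` is normal: `κ` takes values in an abelian group). [folklore] -/
theorem smul_eq_self_of_mem_layerSubgroup {n : ℕ} {g : absoluteGaloisGroup K} (hg : g ∈ κ.layerSubgroup n) (y : absoluteGaloisGroup K ⧸ κ.layerSubgroup n) :
    g • y = y := by
  induction y using QuotientGroup.induction_on with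
  | H x =>
    rw [MulAction.Quotient.smul_mk, smul_eq_mul, QuotientGroup.eq, mul_inv_rev]
    exact (inferInstance : (κ.layerSubgroup n).Normal).conj_mem' g⁻¹ (inv_mem hg) x

end Orbits

/-! ## §2 The levelwise uniform bound -/

section Bound

variable {K : Type} [Field K] [NumberField K] {p : ℕ} [Fact p.Prime] (S : Set (PadicAlgCl p)) [FiniteDimensional ℚ_[p] (padicCoeffField S)]
  (κ : ZpExtension K p) (θ' : absoluteGaloisGroup K →ₜ* (padicCoeffIntegers S)ˣ) (P : Set (HeightOneSpectrum (𝓞 K))) (w : HeightOneSpectrum (𝓞 K))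

/-- ★★★ **THE LEVELWISE UNIFORM BOUND FOR THE DEGREE-2 SEMILOCAL IWASAWA MODULE AT `w`**: with `τ, σ ∈ Γ_{K_w}` as in the module docstring
(`τ` over `K_∞ K_w(μ_{p^∞})` acting on `𝒪 ⊗ μ ⊗ θ′` as the scalar `u`, `u − 1 ∣ p^m`; `κ(res σ) = p^e·unit`), for ALL `n, k`:
`H²(Γ_{K_w}, Maps(Γ_K ⧸ U_n, X_k))` is finite of cardinality `≤ #(𝒪 / p^m 𝒪)^{p^e}`. [cite: NeukirchSchmidtWingberg2008, (7.2.6), (8.6.2)] [cite: MilneADT2006, I Cor. 2.3]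
[cite: PerrinRiou1994Invent, §1.3] -/
theorem finite_and_natCard_semilocCoh_two_le
    {τ : absoluteGaloisGroup (w.adicCompletion K)} (hτU : ∀ n, resGalOfEmb (closureEmb (K := K) (w.adicCompletion K)) τ ∈ κ.layerSubgroup n)
    (hτμ : ∀ (k : ℕ) (ζ : MuCarrier (w.adicCompletion K) (p ^ k)), mu (w.adicCompletion K) (p ^ k) τ ζ = ζ)
    {u : padicCoeffIntegers S}
    (hτX : ∀ (k : ℕ) (x : OMuCarrier K S (p ^ k)), muTwistO S θ' k (resGalOfEmb (closureEmb (K := K) (w.adicCompletion K)) τ) x = oMuScalar S (p ^ k) u x)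
    {m : ℕ} (hum : u - 1 ∣ ((p : ℕ) : padicCoeffIntegers S) ^ m)
    {σ : absoluteGaloisGroup (w.adicCompletion K)} {e : ℕ} {u₀ : ℤ_[p]ˣ}
    (hσ : (κ (resGalOfEmb (closureEmb (K := K) (w.adicCompletion K)) σ)).toAdd = (p : ℤ_[p]) ^ e * u₀) (n k : ℕ) :
    Finite (semilocCoh S κ θ' P w n k 2) ∧
      Nat.card (semilocCoh S κ θ' P w n k 2) ≤
        Nat.card (padicCoeffIntegers S ⧸ (Ideal.span {((p : ℕ) : padicCoeffIntegers S) ^ m} : Ideal (padicCoeffIntegers S))) ^ p ^ e := by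
  haveI : CharZero (w.adicCompletion K) := charZero_of_injective_algebraMap (algebraMap K (w.adicCompletion K)).injective
  haveI : NeZero (p ^ k) := ⟨pow_ne_zero _ (Fact.out : p.Prime).ne_zero⟩
  haveI := SmallImageRttD2J2Delta.finite_coeffGSO P S θ' k
  haveI := SmallImageRttD2Seq.finite_oMuCarrier (K := K) S k
  haveI hfinΩ : Finite (MuCarrier (w.adicCompletion K) (p ^ k)) := finite_muCarrier (w.adicCompletion K) (p ^ k)
  haveI : Finite (absoluteGaloisGroup K ⧸ κ.layerSubgroup n → (coeffRepK S θ' P k).toTopRep) :=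
    ContinuousRep.finite_coindOpen (κ.layerSubgroup n) (κ.isOpen_layerSubgroup n)
  haveI : Finite (absoluteGaloisGroup K ⧸ κ.layerSubgroup e) := Subgroup.quotient_finite_of_isOpen _ (κ.isOpen_layerSubgroup e)
  letI : Fintype (absoluteGaloisGroup K ⧸ κ.layerSubgroup e) := Fintype.ofFinite _
  set res := resGalOfEmb (closureEmb (K := K) (w.adicCompletion K)) with hres
  -- (0) local duality (2,0)
  obtain ⟨hfin, hcard⟩ := natCard_two_eq_natCard_invariants_homRep (w.adicCompletion K)
    (((coeffRepK S θ' P k).coindOpen (κ.layerSubgroup n) (κ.isOpen_layerSubgroup n)).restrict res) (fun φ ↦ by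
      funext y
      rw [Pi.smul_apply, Pi.zero_apply, ← natCast_zsmul, Nat.cast_pow]
      exact coeffGSO_torsion S P θ' k _)
  refine ⟨hfin, ?_⟩
  change Nat.card (continuousCohomology 2 (((coeffRepK S θ' P k).coindOpen (κ.layerSubgroup n) (κ.isOpen_layerSubgroup n)).restrict res).toTopRep) ≤ _
  rw [hcard]
  -- (1) orbit count (part 1, §2)
  have h1 := natCard_invariants_homRep_coindOpen_le (coeffRepK S θ' P k) (κ.layerSubgroup n) (κ.isOpen_layerSubgroup n) res
    (mu (w.adicCompletion K) (p ^ k)) (ι := absoluteGaloisGroup K ⧸ κ.layerSubgroup e)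
    (fun d ↦ (QuotientGroup.mk d.out : absoluteGaloisGroup K ⧸ κ.layerSubgroup n)) (fun y ↦ by
      obtain ⟨t, d, h⟩ := exists_pow_smul_mk_out_eq κ hσ n y
      exact ⟨σ ^ t, d, by rw [map_pow]; exact h⟩) τ (smul_eq_self_of_mem_layerSubgroup κ (hτU n))
  refine h1.trans ?_
  have hι : Fintype.card (absoluteGaloisGroup K ⧸ κ.layerSubgroup e) = p ^ e := by
    rw [← Nat.card_eq_fintype_card, ← Subgroup.index_eq_card, κ.index_layerSubgroup]
  rw [hι]
  refine Nat.pow_le_pow_left ?_ _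
  -- (2) the `τ`-fixed homomorphisms kill `(u - 1) X_k`
  let φ : (coeffRepK S θ' P k).toTopRep →+ (coeffRepK S θ' P k).toTopRep :=
    (coeffMapO S P θ' (oMuScalar S (p ^ k) (u - 1)) (oMuScalar_muTwistO S θ' k (u - 1))).toAddMonoidHom
  have hφ : ∀ x : (coeffRepK S θ' P k).toTopRep, φ x = (coeffRepK S θ' P k) (res τ) x - x := fun x ↦ by
    apply Subtype.ext
    change oMuScalar S (p ^ k) (u - 1) (x : OMuCarrier K S (p ^ k)) = muTwistO S θ' k (res τ) (x : OMuCarrier K S (p ^ k)) - (x : OMuCarrier K S (p ^ k))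
    rw [hτX]
    have h := oMuScalar_add S (p ^ k) (u - 1) 1 (x : OMuCarrier K S (p ^ k))
    rw [sub_add_cancel, oMuScalar_one] at h
    exact eq_sub_of_add_eq h.symm
  haveI : Finite ((coeffRepK S θ' P k).toTopRep →+ MuCarrier (w.adicCompletion K) (p ^ k)) :=
    Finite.of_injective (fun g ↦ (g : (coeffRepK S θ' P k).toTopRep → MuCarrier (w.adicCompletion K) (p ^ k))) DFunLike.coe_injective
  have h2 : Nat.card {g : (coeffRepK S θ' P k).toTopRep →+ MuCarrier (w.adicCompletion K) (p ^ k) //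
        ∀ x, g ((coeffRepK S θ' P k) (res τ) x) = mu (w.adicCompletion K) (p ^ k) τ (g x)} ≤
      Nat.card {g : (coeffRepK S θ' P k).toTopRep →+ MuCarrier (w.adicCompletion K) (p ^ k) // ∀ x, g (φ x) = 0} := by
    refine Nat.card_le_card_of_injective (fun g ↦ ⟨g.1, fun x ↦ ?_⟩) (fun g g' h ↦ ?_)
    · rw [hφ, map_sub, g.2 x, hτμ, sub_self]
    · have hh := congrArg Subtype.val h
      exact Subtype.ext hh
  refine h2.trans ?_
  -- (3) `#{g | g ∘ φ = 0} ≤ #ker φ ≤ #X_k[p^m] ≤ #(𝒪 ⊗ μ)[p^m] ≤ #(𝒪/p^m)`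
  refine (natCard_subtype_comp_eq_zero_le_natCard_ker (muEquivZMod (w.adicCompletion K) (p ^ k)) φ).trans ?_
  obtain ⟨b, hb⟩ := hum
  have hns : ∀ y : OMuCarrier K S (p ^ k), (p ^ m) • y = oMuScalar S (p ^ k) (((p : ℕ) : padicCoeffIntegers S) ^ m) y := fun y ↦ by
    induction y using OMuCarrier.induction_on with
    | zero => rw [smul_zero, map_zero]
    | tmul a v =>
      rw [oMuScalar_tmul, ← Nat.cast_pow, ← nsmul_eq_mul]
      change (p ^ m) • OMuCarrier.toTensor.symm (a ⊗ₜ[ℤ] v) = OMuCarrier.toTensor.symm (((p ^ m) • a) ⊗ₜ[ℤ] v)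
      rw [← map_nsmul, TensorProduct.smul_tmul']
    | add x y hx hy => rw [smul_add, map_add, hx, hy]
  have h3 : φ.ker ≤ (nsmulAddMonoidHom (α := (coeffRepK S θ' P k).toTopRep) (p ^ m)).ker := by
    intro x hx
    rw [AddMonoidHom.mem_ker] at hx ⊢
    apply Subtype.ext
    have hx' : oMuScalar S (p ^ k) (u - 1) (x : OMuCarrier K S (p ^ k)) = 0 := congrArg Subtype.val hx
    change (((p ^ m) • x : (coeffRepK S θ' P k).toTopRep) : OMuCarrier K S (p ^ k)) = 0
    rw [AddSubmonoidClass.coe_nsmul, hns, hb, mul_comm, oMuScalar_mul, hx', map_zero]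
  refine (Nat.card_le_card_of_injective _ (AddSubgroup.inclusion_injective h3)).trans ?_
  refine le_trans ?_ (natCard_torsionBy_oMuCarrier_le (K := K) S k m)
  refine Nat.card_le_card_of_injective (fun x ↦ ⟨((x : (coeffRepK S θ' P k).toTopRep) : OMuCarrier K S (p ^ k)), ?_⟩) ?_
  · have hx : (p ^ m) • (x : (coeffRepK S θ' P k).toTopRep) = 0 := x.2
    rw [AddMonoidHom.mem_ker]
    change (p ^ m) • ((x : (coeffRepK S θ' P k).toTopRep) : OMuCarrier K S (p ^ k)) = 0
    rw [← AddSubmonoidClass.coe_nsmul, hx]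
    rfl
  · intro x y h
    have hh := congrArg Subtype.val h
    exact Subtype.ext (Subtype.ext hh)

/-- ★★★ **α2-lev PACKAGED for LEAD g14's `finite_pi_semiloc_of_levels` / `SemilocIwasawaCohomologyDataO.finite_and_natCard_le_of_levels` (p813183)**: under the local hypotheses at `w`,
ALL levels of the degree-2 semilocal Iwasawa module at `w` are finite and UNIFORMLY bounded — so `(L₂ w).H` is finite. [cite: NeukirchSchmidtWingberg2008, (8.6.2)–(8.6.3)]
[cite: PerrinRiou1994Invent, §1.3] -/
theorem exists_bound_semilocCoh_two
    {τ : absoluteGaloisGroup (w.adicCompletion K)} (hτU : ∀ n, resGalOfEmb (closureEmb (K := K) (w.adicCompletion K)) τ ∈ κ.layerSubgroup n)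
    (hτμ : ∀ (k : ℕ) (ζ : MuCarrier (w.adicCompletion K) (p ^ k)), mu (w.adicCompletion K) (p ^ k) τ ζ = ζ)
    {u : padicCoeffIntegers S}
    (hτX : ∀ (k : ℕ) (x : OMuCarrier K S (p ^ k)), muTwistO S θ' k (resGalOfEmb (closureEmb (K := K) (w.adicCompletion K)) τ) x = oMuScalar S (p ^ k) u x)
    {m : ℕ} (hum : u - 1 ∣ ((p : ℕ) : padicCoeffIntegers S) ^ m)
    {σ : absoluteGaloisGroup (w.adicCompletion K)} {e : ℕ} {u₀ : ℤ_[p]ˣ}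
    (hσ : (κ (resGalOfEmb (closureEmb (K := K) (w.adicCompletion K)) σ)).toAdd = (p : ℤ_[p]) ^ e * u₀) :
    (∀ n k, Finite (semilocCoh S κ θ' P w n k 2)) ∧ ∃ B : ℕ, ∀ n k, Nat.card (semilocCoh S κ θ' P w n k 2) ≤ B :=
  ⟨fun n k ↦ (finite_and_natCard_semilocCoh_two_le S κ θ' P w hτU hτμ hτX hum hσ n k).1,
    ⟨_, fun n k ↦ (finite_and_natCard_semilocCoh_two_le S κ θ' P w hτU hτμ hτX hum hσ n k).2⟩⟩

/-- **The limit form**: under the same local hypotheses the pinned degree-2 semilocal Iwasawa module `(L₂ w).H = 𝐇²_{Iw}(K_w ⊗ K_∞, T*)` (-w3's `SemilocIwasawaCohomologyDataO … w 2`, any pins)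
is FINITE, of cardinality `≤ #(𝒪/p^m)^{p^e}` (LEAD g14 `SemilocIwasawaCohomologyDataO.finite_and_natCard_le_of_levels`). [cite: NeukirchSchmidtWingberg2008, (8.6.2)–(8.6.3)] [cite: PerrinRiou1994Invent, §1.3] -/
theorem finite_semilocIwasawaCohomologyDataO_two {γ : absoluteGaloisGroup K} (L : SemilocIwasawaCohomologyDataO S κ γ θ' P w 2)
    {τ : absoluteGaloisGroup (w.adicCompletion K)} (hτU : ∀ n, resGalOfEmb (closureEmb (K := K) (w.adicCompletion K)) τ ∈ κ.layerSubgroup n)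
    (hτμ : ∀ (k : ℕ) (ζ : MuCarrier (w.adicCompletion K) (p ^ k)), mu (w.adicCompletion K) (p ^ k) τ ζ = ζ)
    {u : padicCoeffIntegers S}
    (hτX : ∀ (k : ℕ) (x : OMuCarrier K S (p ^ k)), muTwistO S θ' k (resGalOfEmb (closureEmb (K := K) (w.adicCompletion K)) τ) x = oMuScalar S (p ^ k) u x)
    {m : ℕ} (hum : u - 1 ∣ ((p : ℕ) : padicCoeffIntegers S) ^ m)
    {σ : absoluteGaloisGroup (w.adicCompletion K)} {e : ℕ} {u₀ : ℤ_[p]ˣ}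
    (hσ : (κ (resGalOfEmb (closureEmb (K := K) (w.adicCompletion K)) σ)).toAdd = (p : ℤ_[p]) ^ e * u₀) :
    Finite L.H ∧ Nat.card L.H ≤ Nat.card (padicCoeffIntegers S ⧸ (Ideal.span {((p : ℕ) : padicCoeffIntegers S) ^ m} : Ideal (padicCoeffIntegers S))) ^ p ^ e :=
  L.finite_and_natCard_le_of_levels (fun n k ↦ (finite_and_natCard_semilocCoh_two_le S κ θ' P w hτU hτμ hτX hum hσ n k).1)
    (fun n k ↦ (finite_and_natCard_semilocCoh_two_le S κ θ' P w hτU hτμ hτX hum hσ n k).2)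

end Bound

end Summit.BirchSwinnertonDyer.BirchSwinnertonDyer.Theorems.SmallImageRttJunctionSha

end
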